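import Summits.BirchSwinnertonDyer.BirchSwinnertonDyer.Theorems.Rank1ResidualJetKolyvaginClassLocal
import Summits.BirchSwinnertonDyer.BirchSwinnertonDyer.Theorems.Rank1ResidualJetStringentEnd
import Summits.BirchSwinnertonDyer.BirchSwinnertonDyer.Theorems.Rank1ResidualJetUnramifiedReceptacleCoboundary
import Summits.BirchSwinnertonDyer.BirchSwinnertonDyer.Theorems.Rank1ResidualJetReceptacleRational
import Summits.BirchSwinnertonDyer.BirchSwinnertonDyer.Theorems.Rank1ResidualJetSelmerDefs
import Literature.NumberTheory.EllipticCurves.RootNumberProofs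
import HarnessLib

/-!
# T1 JET (cell `bsd-jet`), road K, K-GAP-2 (`h49str`), step (C3): Jetchev 2008 Prop. 4.9 for OUR
# Kolyvagin class — `loc_v c_k(c) ∈ JET.stringentFamily v` at EVERY place `v ∤ c`, modulo [GZ86 III (3.1)]

HONEST FRAMING (programme file §HONESTY, verbatim): «no tranche here proves BSD; ARM L moves the
LITERAL column of an r ≤ 1 census into the kernel-proved-modulo-named-print column.» THEOREMS ONLY
(seat `bsd-jet-pv-1`, session g7; `--supports stmt-BirchSwinnertonDyer-14418`, helper); 0 classes
move. WHAT THIS IS. pv-2's `JET.hloc_concrete_of_GZ31_zhang` / `localization_kolyvaginClass_mem_kummerSelmerStructure_of_GZ31`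
(`Rank1ResidualJetKolyvaginClassLocal`, p498xxx) prove the KUMMER condition `loc_v c_k(c) ∈ H¹_Kum` at
every `v ∤ c` modulo `hGZ` ([GZ86 III (3.1)] in the receptacle form). This file proves the STRINGENT
condition of Jetchev's Prop. 4.9 (printed Prop. 4.1) for the same class: at a finite BAD place the
receptacle END is replaced by the stringent END (`Stringent.exists_localKummerMap_eq_res_kolyvaginClass_kolyvaginPoint_of_GZ31`,
C2) fed with the STRONG Milne I.3.8 (`StrongMilne.exists_mem_E0Receptacle_eq_smul_sub`, A4), and the
receptacle is read on rational points (`Receptacle.mem_goodReductionSubgroup_of_mem_E0Receptacle`, B):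
* `exists_localKummerMap_eq_res_kolyvaginClass_concrete_of_GZ31_zhang` — pv-2's proof VERBATIM up to its
  last line: at a finite bad `v ∤ m`, `res_v c_M(m) = δ_v(t)` with `e(t) ∈ E⁰(K̄_v)`;
* `localization_kolyvaginClass_mem_stringentFamily_of_GZ31` — **in the `H63` binder currency: for
  `c ∈ Λ_k`, a datum `d`, and EVERY place `v` of `K` not over a prime factor of `c`,
  `loc_v c_k(c) ∈ JET.stringentFamily W K hn v`**: complex / non-minimal / good places are the Kummer
  condition (pv-2's theorem; at a good minimal place `Kum⁰ = Kum` by x11b3's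
  `connectedKummerCondition_eq_of_goodReductionSubgroup_eq_top`), bad minimal places are the new chain.
  Applied at the carrier pair `{v₀, τ•v₀}` (places over `N`) this is the binder `h49str` of
  `JET.tamagawaExponent_le_mInfty_of_localFacts'` — uniformly in `q = p` / `q ≠ p`.
References: [cite: Jetchev2008, Def. 4.8, Prop. 4.9 (arXiv numbering) = Prop. 4.1 (pp. 819–821), §3.1 (p. 814)]
[cite: GrossLMS1991, §6 Prop. 6.2 (1) and proof (pp. 244–245)] [cite: GrossZagier1986, III (3.1)]
[cite: MilneADT2006, Ch. I Prop. 3.8] [cite: McCallumLMS1991, Lemma 4.3, §4 (4)–(6)].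
-/

set_option autoImplicit false

noncomputable section

open scoped Classical
open WeierstrassCurve Field NumberField IsDedekindDomain Finset
open Literature.NumberTheory.EllipticCurves Literature.NumberTheory.GaloisRepresentations
open Literature.NumberTheory.EllipticCurves.KolyvaginCocycle Literature.NumberTheory.EllipticCurves.KolyvaginEuler
open Literature.NumberTheory.EllipticCurves.RingClassField Literature.NumberTheory.EllipticCurves.ModularForms
open Summit.BirchSwinnertonDyer.Rank1Residual.X11b Summit.BirchSwinnertonDyer.Rank1Residual.X11b.Three
open Summit.BirchSwinnertonDyer.Rank1Residual.X11b.Three.GrossBadPlace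
open Summit.BirchSwinnertonDyer.Rank1Residual.X11b.KolyvaginHloc

namespace Summit.BirchSwinnertonDyer.Rank1Residual.JET

-- `K : Type`: the tree's ring-class class field theory is universe `0`.
variable {K : Type} [Field K] [NumberField K] {N : ℕ} {W : WeierstrassCurve ℚ}

/-- **Jetchev 2008 Prop. 4.9 (stringent condition) for the CONCRETE classes at ZHANG–Kolyvagin levels,
bad places**: pv-2's `hloc_concrete_of_GZ31_zhang` VERBATIM (the seam with x11b3-p2's level data, the
Euler-system inputs, `hI`, the subgroup `E′` generated by the `𝒢_m`-orbits of `y(m)`, `y(m/ℓ)↑`, the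
receptacle clause from `hGZ`, `Tr_ℓ y = a_ℓ y(m/ℓ)↑` with `p^M ∣ a_ℓ`) with its last line — the receptacle
END — replaced by the stringent END (C2) and the strong Milne I.3.8 (A4). CONCLUSION: at a finite place
`v ∤ m` of BAD reduction, `res_v c_M(m) = δ_v(t)` for some `t ∈ E(K_v)` whose image lies in `E⁰(K̄_v)`.
CONDITIONAL on `hGZ` ([GZ86 III (3.1)], cite-only), `hcop`, `hA`, as the original.
[cite: Jetchev2008, Prop. 4.9 (arXiv) = Prop. 4.1 (pp. 819–821)] [cite: GrossLMS1991, §6 Prop. 6.2 (1)]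
[cite: GrossZagier1986, III (3.1)] [cite: MilneADT2006, Ch. I Prop. 3.8] -/
theorem exists_localKummerMap_eq_res_kolyvaginClass_concrete_of_GZ31_zhang [NeZero N] [W.IsElliptic]
    [W.IsGloballyMinimal]
    (hK : IsImaginaryQuadratic K) (ι : K →+* ℂ)
    {p M : ℕ} (hp : p.Prime)
    (Dt : ModularParametrizationData W N) {β : ℤ}
    (hND : IsCoprime (N : ℤ) (NumberField.discr K)) (hD : NumberField.discr K < -4)
    {n : ℕ} (hn : Squarefree n)
    (hkol : ∀ q ∈ n.primeFactors,
      Zhang2014.IsKolyvaginPrime N W K p q ∧ M ≤ Zhang2014.kolyvaginIndex W p q)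
    (d : (m : ℕ) → m ∣ n → KolyvaginHeegnerData Dt β ι m)
    {n' : ℤ} (hcop : IsCoprime ((p ^ M : ℕ) : ℤ) n')
    (hGZ : ∀ (m : ℕ) (hm : m ∣ n) (γ : ringClassField K ι m ≃ₐ[ℚ] ringClassField K ι m),
      γ ∈ ringClassGal ι m → ∀ v : HeightOneSpectrum (𝓞 K), ¬ (W.baseChange K).HasGoodReductionAt v →
        n' • pointsMap (W.baseChange K) (v.adicCompletion K)
            ((d m hm).toGeomPoints (pointGalHom W (ringClassField K ι m) γ (d m hm).y)) ∈
          E0Receptacle (W.baseChange K) v ∧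
        ∀ (ℓ : ℕ) (hℓ : ℓ ∈ m.primeFactors)
          (hle : ringClassField K ι (m / ℓ) ≤ ringClassField K ι m),
          n' • pointsMap (W.baseChange K) (v.adicCompletion K)
              ((d m hm).toGeomPoints (pointGalHom W (ringClassField K ι m) γ
                (WeierstrassCurve.Affine.Point.map (W' := W)
                  ((RingClassField.inclusion ι hle).restrictScalars ℚ)
                  (d (m / ℓ) ((Nat.div_dvd_of_dvd (Nat.dvd_of_mem_primeFactors hℓ)).trans hm)).y))) ∈
            E0Receptacle (W.baseChange K) v)
    (hA : ∀ (m : ℕ) (hm : m ∣ n),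
      IsAdmissible (absoluteGaloisGroup K) (d m hm).pointsSubgroup ((p ^ M : ℕ) : ℤ))
    (hn' : ((p ^ M : ℕ) : ℤ) ≠ 0) :
    ∀ (m : ℕ) (hm : m ∣ n) (v : HeightOneSpectrum (𝓞 K)), (m : 𝓞 K) ∉ v.asIdeal →
      ¬ (W.baseChange K).HasGoodReductionAt v →
      ∃ t : ((W.baseChange K).baseChange (v.adicCompletion K)).toAffine.Point,
        (W.baseChange K).baseChangeGeomPointsEquiv (v.adicCompletion K)
            (toGeomPoints ((W.baseChange K).baseChange (v.adicCompletion K)) t) ∈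
          E0Receptacle (W.baseChange K) v ∧
        (W.baseChange K).localKummerMap (v.adicCompletion K) hn' t =
          galoisCohomology.res ((W.baseChange K).torsionGaloisModule ((p ^ M : ℕ) : ℤ))
            (v.adicCompletion K) 1 ((d m hm).kolyvaginClass hp M) := by
  intro m hm v hmv hgood
  haveI : Fact p.Prime := ⟨hp⟩
  have hn0 : n ≠ 0 := Squarefree.ne_zero hn
  have hm0 : m ≠ 0 := ne_zero_of_dvd_ne_zero hn0 hm
  have hinert : ∀ q ∈ n.primeFactors, (Ideal.span {(q : 𝓞 K)}).IsPrime :=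
    fun q hq ↦ (hkol q hq).1.2.2.2.2.1
  have hdiv : ∀ Q : geomPoints (W.baseChange K), ∃ R, ((p ^ M : ℕ) : ℤ) • R = Q :=
    (W.baseChange K).zsmul_geomPoints_surjective_of_charZero
      (by exact_mod_cast pow_ne_zero M hp.ne_zero)
  -- THE SEAM: level data at every level (x11b3-p2 GEN 7, `exists_levelData`)
  choose σ H f y π j e hord hj hπρ hfsec hHρ hdict hjunk using
    fun k ↦ KolyvaginH44.exists_levelData (W := W) (Dt := Dt) (β := β) hK ι hn hinert d k
  -- `𝒢_m = ringClassGal ι m`, a finite commutative group acting on `E(K[m])` through `pointGalHom`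
  letI hcg : ∀ k, CommGroup (ringClassGal ι k) := fun k ↦
    { (inferInstance : Group (ringClassGal ι k)) with
      mul_comm := fun a b ↦ (KolyvaginH44.isMulCommutative_ringClassGal' hK ι k).is_comm.comm a b }
  haveI hfin : ∀ k, Finite (ringClassGal ι k) := KolyvaginH44.finite_ringClassGal hK ι
  letI act : ∀ k, DistribMulAction (ringClassGal ι k)
      ((W.baseChange (ringClassField K ι k)).toAffine.Point) := fun k ↦
    DistribMulAction.compHom _ ((pointGalHom W (ringClassField K ι k)).comp (ringClassGal ι k).subtype)
  letI hft : ∀ k, Fintype (ringClassGal ι k ⧸ H k) := fun k ↦ Fintype.ofFinite _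
  have hsmul : ∀ (k) (g : ringClassGal ι k) (Q : (W.baseChange (ringClassField K ι k)).toAffine.Point),
      g • Q = pointGalHom W (ringClassField K ι k)
        (g : ringClassField K ι k ≃ₐ[ℚ] ringClassField K ι k) Q := fun _ _ _ ↦ rfl
  -- the inclusion `ρ_m : 𝒢_m ≤ Aut_ℚ(K[m])` (the identity `iA_m` is `AddEquiv.refl`)
  set ρ : ∀ k, ringClassGal ι k →* (ringClassField K ι k ≃ₐ[ℚ] ringClassField K ι k) :=
    fun k ↦ (ringClassGal ι k).subtype with hρdef
  have hρ : ∀ k, Function.Injective (ρ k) := fun k ↦ (ringClassGal ι k).subtype_injective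
  have hj' : ∀ (k) (g : absoluteGaloisGroup K)
      (a : (W.baseChange (ringClassField K ι k)).toAffine.Point),
      j k (π k g • a) = g • j k a := fun k g a ↦ by rw [hsmul]; exact hj k g a
  have hπρ' : ∀ (k) (τ : absoluteGaloisGroup K) (x : ringClassField K ι k),
      τ • e k x = e k (ρ k (π k τ) x) := fun k τ x ↦ hπρ k τ x
  -- the abstract Kolyvagin point IS `P(m)` at the divisors (x11b3-p8's G1)
  have hP : ∀ (k) (hk : k ∣ n),
      j k (kolyvaginPoint (σ k) k.primeFactors (f k) (y k)) =
        (d k hk).toGeomPoints (d k hk).derivedPoint := by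
    intro k hk
    obtain ⟨hjk, hyk, hσk, hfS⟩ := hdict k hk
    rw [hjk, hyk]
    congr 1
    have hbij := KolyvaginH37Bridge.bijOn_of_section_of_transversal (ρ k) (hρ k)
      (H := H k) (Γ := ringClassGal ι k) (G₁ := ringClassGalOver ι k 1) (hHρ k)
      (S := ((d k hk).S : Set _)) (fun s hs ↦ (d k hk).S_subset s hs)
      (fun s hs ↦ ⟨⟨s, (d k hk).S_subset s hs⟩, rfl⟩) (d k hk).S_transversal (f k) (hfsec k) hfS
    exact KolyvaginH37Bridge.map_kolyvaginPoint_eq_derivedPoint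
      (pointGalHom W (ringClassField K ι k)) (ρ k) (AddMonoidHom.id _) (fun g a ↦ hsmul k g a)
      (hn.squarefree_of_dvd hk) hσk (f k) hbij (d k hk).y
  -- the dictionary clauses the abstract ENDs read
  have hyA : ∀ (k : ℕ) (hk : k ∣ n), AddEquiv.refl _ (y k) = (d k hk).y :=
    fun k hk ↦ (hdict k hk).2.1
  have hσA : ∀ (k : ℕ) (hk : k ∣ n), ∀ q ∈ k.primeFactors, ρ k (σ k q) = (d k hk).σ q :=
    fun k hk ↦ (hdict k hk).2.2.1
  -- `hA`, `hPt` (P4-A), `hgen`, `hdvd`, `hI` (P4-B) at level `m`, in ABSTRACT currency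
  have hA' : IsAdmissible (absoluteGaloisGroup K) (j m).range ((p ^ M : ℕ) : ℤ) := by
    rw [(hdict m hm).1]; exact hA m hm
  have hPt' : j m (kolyvaginPoint (σ m) m.primeFactors (f m) (y m)) ∈
      invPoints (absoluteGaloisGroup K) (j m).range ((p ^ M : ℕ) : ℤ) :=
    KolyCert.kolyvaginPoint_mem_invPoints_of_dvd_zhang hK ι Dt hp hND hD hn hkol d σ
      (fun k ↦ k.primeFactors) H f y π j hj' ρ hρ (fun _ ↦ AddEquiv.refl _)
      (fun k _ g a ↦ hsmul k g a) hyA hσA (fun _ _ ↦ rfl) (fun k _ ↦ hfsec k) (fun k _ ↦ hHρ k)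
      m hm
  have hgen : H m ≤ Subgroup.closure (σ m '' (m.primeFactors : Set ℕ)) :=
    KolyvaginH44.le_closure_of_dvd hK ι Dt hn d σ (fun k ↦ k.primeFactors) H ρ hρ hσA
      (fun _ _ ↦ rfl) (fun k _ ↦ hHρ k) m hm
  have hdvd : ∀ ℓ ∈ m.primeFactors, ((p ^ M : ℕ) : ℤ) ∣ ((ℓ + 1 : ℕ) : ℤ) := by
    intro ℓ hℓ
    obtain ⟨-, hℓM⟩ := hkol ℓ (Nat.primeFactors_mono hm hn0 hℓ)
    exact Int.natCast_dvd_natCast.mpr (Zhang2014.le_kolyvaginIndex_iff.mp hℓM).1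
  obtain ⟨𝔐, h𝔐⟩ := v.localPrimesAbove_nonempty
  have hI' : ∀ t ∈ 𝔐.inertia (absoluteGaloisGroup (v.adicCompletion K)),
      resGal (K := K) (v.adicCompletion K) t • j m (kolyvaginPoint (σ m) m.primeFactors (f m) (y m)) =
        j m (kolyvaginPoint (σ m) m.primeFactors (f m) (y m)) :=
    KolyvaginH44.smul_kolyvaginPoint_eq_of_mem_localInertia (W := W) hK ι σ
      (fun k ↦ k.primeFactors) H f y π j hj' e ρ hρ hπρ' m v hmv 𝔐 h𝔐
  -- the abstract class IS the concrete class `c_M(m)`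
  have hPt : (d m hm).toGeomPoints (d m hm).derivedPoint ∈
      invPoints (absoluteGaloisGroup K) (d m hm).pointsSubgroup ((p ^ M : ℕ) : ℤ) := by
    have h := hPt'
    rw [hP m hm, (hdict m hm).1] at h
    exact h
  have hc : (d m hm).kolyvaginClass hp M =
      kolyvaginClass (W.baseChange K) ((p ^ M : ℕ) : ℤ) hdiv hA'
        (j m (kolyvaginPoint (σ m) m.primeFactors (f m) (y m))) hPt' := by
    rw [KolyvaginHeegnerData.kolyvaginClass_of_admissible _ hp M (hA m hm) hPt]
    exact KolyvaginH44.kolyvaginClass_congr (by rw [(hdict m hm).1]; rfl) (hP m hm).symm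
  rw [hc]
  -- bad `v`: the STRINGENT `E⁰(K̄_v)`-receptacle END (C2 + strong Milne A4)
  have hm' : ∀ {ℓ : ℕ}, ℓ ∈ m.primeFactors → m / ℓ ∣ n := fun hℓ ↦
    (Nat.div_dvd_of_dvd (Nat.dvd_of_mem_primeFactors hℓ)).trans hm
  have hle : ∀ {ℓ : ℕ}, ℓ ∈ m.primeFactors → ringClassField K ι (m / ℓ) ≤ ringClassField K ι m :=
    fun hℓ ↦ ringClassField_mono hK ι (Nat.div_dvd_of_dvd (Nat.dvd_of_mem_primeFactors hℓ)) hm0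
  -- `E′_m`: generated by the `𝒢_m`-orbits of `y(m)` and of the `y(m/ℓ)↑` read in `E(K[m])`
  set S : Set ((W.baseChange (ringClassField K ι m)).toAffine.Point) :=
    {x | ∃ γ : ringClassGal ι m, x = γ • (d m hm).y ∨ ∃ (ℓ : ℕ) (hℓ : ℓ ∈ m.primeFactors),
      x = γ • WeierstrassCurve.Affine.Point.map (W' := W)
        ((RingClassField.inclusion ι (hle hℓ)).restrictScalars ℚ) (d (m / ℓ) (hm' hℓ)).y}
    with hSdef
  have hSstab : ∀ (g : ringClassGal ι m), ∀ s ∈ S, g • s ∈ S := by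
    rintro g s ⟨γ, h | ⟨ℓ, hℓ, h⟩⟩
    · refine ⟨g * γ, Or.inl ?_⟩
      rw [h]; exact (mul_smul g γ _).symm
    · refine ⟨g * γ, Or.inr ⟨ℓ, hℓ, ?_⟩⟩
      rw [h]; exact (mul_smul g γ _).symm
  have hyS : y m ∈ S := by
    rw [(hdict m hm).2.1]; exact ⟨1, Or.inl (one_smul _ _).symm⟩
  have hzS : ∀ (ℓ : ℕ) (hℓ : ℓ ∈ m.primeFactors),
      WeierstrassCurve.Affine.Point.map (W' := W)
        ((RingClassField.inclusion ι (hle hℓ)).restrictScalars ℚ) (d (m / ℓ) (hm' hℓ)).y ∈ S :=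
    fun ℓ hℓ ↦ ⟨1, Or.inr ⟨ℓ, hℓ, (one_smul _ _).symm⟩⟩
  -- the receptacle clause on the generators, from `hGZ`
  have hrecS : ∀ s ∈ S, n' • pointsMap (W.baseChange K) (v.adicCompletion K) (j m s) ∈
      E0Receptacle (W.baseChange K) v := by
    rintro s ⟨γ, h | ⟨ℓ, hℓ, h⟩⟩
    · rw [h, (hdict m hm).1, hsmul]
      exact (hGZ m hm γ γ.2 v hgood).1
    · rw [h, (hdict m hm).1, hsmul]
      exact (hGZ m hm γ γ.2 v hgood).2 ℓ hℓ (hle hℓ)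
  -- `Tr_ℓ y(m) = a_ℓ · y(m/ℓ)↑` with `p^M ∣ a_ℓ` ((β2) + (3.3), x11b3-p4's route, witness kept)
  have htr : ∀ ℓ ∈ m.primeFactors,
      grAct ((W.baseChange (ringClassField K ι m)).toAffine.Point) (traceElt (σ m ℓ) ℓ) (y m) ∈
        (AddSubgroup.closure S).map (zsmulAddGroupHom ((p ^ M : ℕ) : ℤ) :
          (W.baseChange (ringClassField K ι m)).toAffine.Point →+ _) := by
    intro ℓ hℓ
    obtain ⟨hℓp, hℓm, -⟩ := Nat.mem_primeFactors.mp hℓ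
    obtain ⟨hℓK, hℓM⟩ := hkol ℓ (Nat.primeFactors_mono hm hn0 hℓ)
    have hℓm' : ¬ ℓ ∣ m / ℓ :=
      KolyvaginH44.not_dvd_div_of_squarefree_of_prime (hn.squarefree_of_dvd hm) hℓp hℓm
    have hNm : Nat.Coprime N m := KolyvaginH37Bridge.coprime_of_forall_not_dvd hm0
      fun q hq ↦ (hkol q (Nat.primeFactors_mono hm hn0 hq)).1.2.1
    haveI : Fact ℓ.Prime := ⟨hℓp⟩
    -- (β2): Gross Prop. 3.7 (1) for the tree's data, `a_ℓ = W.frobeniusTrace ℓ` currency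
    have hgoodℓ : W.HasGoodReductionAtPrime ℓ :=
      KolyvaginH37Bridge.hasGoodReductionAtPrime_of_modularParametrizationData Dt hℓK.2.1
    have hrelE := HeegnerTrace.frobeniusTrace_smul_eq_of_lFunction_smul_eq hgoodℓ
      (HeegnerTrace.sum_pow_pointGalHom_y_eq_lFunction_smul_map hK ι hND hℓ hℓK.2.2.2.2.1 hℓK.2.1
        hℓm' hNm (Or.inr hD) (d m hm) (d (m / ℓ) (hm' hℓ)) (hle hℓ))
    -- in `A₀ m = E(K[m])` with the `𝒢_m`-action: `Tr_ℓ y(m) = a_ℓ • y(m/ℓ)↑`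
    have hrel : grAct ((W.baseChange (ringClassField K ι m)).toAffine.Point)
        (traceElt (σ m ℓ) ℓ) (y m) = W.frobeniusTrace ℓ •
          WeierstrassCurve.Affine.Point.map (W' := W)
            ((RingClassField.inclusion ι (hle hℓ)).restrictScalars ℚ) (d (m / ℓ) (hm' hℓ)).y := by
      rw [grAct_traceElt, ← hrelE, (hdict m hm).2.1]
      refine Finset.sum_congr rfl fun i _ ↦ ?_
      rw [hsmul, Subgroup.coe_pow, (hdict m hm).2.2.1 ℓ hℓ]
    -- (3.3): `p^M ∣ a_ℓ`
    have haℓ : ((p ^ M : ℕ) : ℤ) ∣ W.frobeniusTrace ℓ := by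
      have h := ((Zhang2014.le_kolyvaginIndex_iff (W := W) (p := p) (M := M) (ℓ := ℓ)).mp hℓM).2
      exact_mod_cast h
    obtain ⟨k, hk⟩ := haℓ
    refine AddSubgroup.mem_map.mpr ⟨k • WeierstrassCurve.Affine.Point.map (W' := W)
        ((RingClassField.inclusion ι (hle hℓ)).restrictScalars ℚ) (d (m / ℓ) (hm' hℓ)).y,
      AddSubgroup.zsmul_mem _ (AddSubgroup.subset_closure (hzS ℓ hℓ)) k, ?_⟩
    rw [zsmulAddGroupHom_apply, smul_smul, ← hk, hrel]
  -- the abstract END at the bad place `v`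
  exact Stringent.exists_localKummerMap_eq_res_kolyvaginClass_kolyvaginPoint_of_GZ31 (W.baseChange K) hn'
    (hfsec m) hgen (hord m) hdvd (π m) (j m) (hj' m) hA' hPt' v hI' (E0Receptacle (W.baseChange K) v)
    (E' := AddSubgroup.closure S) (n' := n')
    ⟨fun γ e he ↦ smul_mem_closure_of_forall_smul_mem hSstab γ he,
      AddSubgroup.subset_closure hyS, htr,
      fun x hx ↦ zsmul_map_mem_of_mem_closure
        ((pointsMap (W.baseChange K) (v.adicCompletion K)).comp (j m))
        (E0Receptacle (W.baseChange K) v) n' hrecS hx⟩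
    hcop
    (fun c hcB hcI ↦ StrongMilne.exists_mem_E0Receptacle_eq_smul_sub (W.baseChange K) v hgood h𝔐 c hcB hcI)


/-- **K-GAP-2 `h49str` in the `H63` binder currency: `loc_v c_k(c) ∈ 𝒮_v` at EVERY place `v ∤ c`**
(`𝒮 = JET.stringentFamily W K hn`, Jetchev's stringent Kummer structure of Def. 4.8 / §3.1 read on
x11b3's connected Kummer condition). For `E/ℚ` globally minimal with `ρ̄_{E,p}` onto at an odd `p`,
`K` imaginary quadratic with `d_K ∉ {−3, −4}` and the Heegner hypothesis for `N = N_E`, a frame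
`(Dt, β, ι)`, `c ∈ Λ` with prime factors of index `≥ k`, ANY datum `d` of conductor `c`, and a place `v`
not over a prime factor of `c`: complex `v` — `H¹(ℂ, ·) = 0`; finite `v` with non-minimal base change —
`𝒮_v = Kum_v` by definition; finite good `v` with minimal base change — `Kum⁰ = Kum` (`E₀ = E`);
these three by pv-2's `localization_kolyvaginClass_mem_kummerSelmerStructure_of_GZ31`; finite BAD `v`
with minimal base change — the stringent chain (`…_concrete_of_GZ31_zhang` above, then
`Receptacle.mem_goodReductionSubgroup_of_mem_E0Receptacle`). GIVEN: `hGZ` = [GZ86 III (3.1)] in the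
receptacle form, `n′` prime to `p`, the two Gross §3 CM facts (data at the divisors of `c`).
[cite: Jetchev2008, Def. 4.8, Prop. 4.9; §3.1 (p. 814)] [cite: GrossLMS1991, §6 Prop. 6.2 (1)]
[cite: GrossZagier1986, III (3.1)] -/
theorem localization_kolyvaginClass_mem_stringentFamily_of_GZ31 [W.IsElliptic] [W.IsGloballyMinimal]
    [NeZero (W.conductorNorm ℤ)]
    (hCM1 : phi_heegnerPointOfConductor_mem_range_map_ringClassField (W.conductorNorm ℤ) W K)
    (hCM2 : exists_generator_ringClassGalOver K)
    (hK : IsImaginaryQuadratic K) (hD3 : NumberField.discr K ≠ -3) (hD4 : NumberField.discr K ≠ -4)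
    (hH : SatisfiesHeegnerHypothesis (W.conductorNorm ℤ) K)
    {p : ℕ} [Fact p.Prime] (hp2 : p ≠ 2) (hρ : W.HasSurjectiveModNGaloisRep p)
    (Dt : ModularParametrizationData W (W.conductorNorm ℤ)) (β : ℤ) (ι : K →+* ℂ)
    {n' : ℤ} (hcop' : IsCoprime (p : ℤ) n')
    (hGZ : ∀ (m : ℕ) (dm : KolyvaginHeegnerData Dt β ι m)
      (γ : ringClassField K ι m ≃ₐ[ℚ] ringClassField K ι m), γ ∈ ringClassGal ι m →
      ∀ v : HeightOneSpectrum (𝓞 K), ¬ (W.baseChange K).HasGoodReductionAt v →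
        n' • pointsMap (W.baseChange K) (v.adicCompletion K)
            (dm.toGeomPoints (pointGalHom W (ringClassField K ι m) γ dm.y)) ∈
          E0Receptacle (W.baseChange K) v ∧
        ∀ (ℓ : ℕ), ℓ ∈ m.primeFactors → ∀ (dm' : KolyvaginHeegnerData Dt β ι (m / ℓ))
          (hle : ringClassField K ι (m / ℓ) ≤ ringClassField K ι m),
          n' • pointsMap (W.baseChange K) (v.adicCompletion K)
              (dm.toGeomPoints (pointGalHom W (ringClassField K ι m) γ
                (WeierstrassCurve.Affine.Point.map (W' := W)
                  ((RingClassField.inclusion ι hle).restrictScalars ℚ) dm'.y))) ∈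
            E0Receptacle (W.baseChange K) v)
    {c : ℕ} (hc : Squarefree c) {k : ℕ} (hn : ((p ^ k : ℕ) : ℤ) ≠ 0)
    (hcK : ∀ ℓ ∈ c.primeFactors, Zhang2014.IsKolyvaginPrime (W.conductorNorm ℤ) W K p ℓ ∧
      k ≤ Zhang2014.kolyvaginIndex W p ℓ)
    (d : KolyvaginHeegnerData Dt β ι c) [∀ j : ℕ, NumberField (ringClassField K ι j)]
    (v : Place K) (hv : ∀ ℓ ∈ c.primeFactors, ¬ Jetchev2008.PlaceOver K v ℓ) :
    galoisCohomology.localization ((W.baseChange K).torsionGaloisModule ((p ^ k : ℕ) : ℤ)) v 1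
        (d.kolyvaginClass (Fact.out : p.Prime) k) ∈ stringentFamily W K hn v := by
  have hp : p.Prime := Fact.out
  -- the Kummer condition at `v` (pv-2), used at complex / non-minimal / good places
  have hKum := localization_kolyvaginClass_mem_kummerSelmerStructure_of_GZ31 hCM1 hCM2 hK hD3 hD4 hH hp2 hρ
    Dt β ι hcop' hGZ hc hcK d v hv
  rcases v with w | 𝔳
  · -- complex place: the stringent family IS the Kummer condition there
    exact hKum
  · by_cases hmin : ((W.baseChange K).baseChange (𝔳.adicCompletion K)).IsMinimal (𝔳.adicCompletionIntegers K)
    swap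
    · -- non-minimal base change: `𝒮_v = Kum_v` by definition
      rw [show stringentFamily W K hn (Sum.inr 𝔳) =
          (W.baseChange K).kummerSelmerStructure ((p ^ k : ℕ) : ℤ) (Sum.inr 𝔳) by
        simp only [stringentFamily, dif_neg hmin]]
      exact hKum
    haveI := hmin
    haveI : CharZero (𝔳.adicCompletion K) :=
      charZero_of_injective_algebraMap (algebraMap K _).injective
    rw [stringentFamily_inr_of_isMinimal W K hn 𝔳]
    by_cases hgood : (W.baseChange K).HasGoodReductionAt 𝔳
    · -- good minimal place: `E₀(K_v) = E(K_v)`, so `Kum⁰ = Kum`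
      haveI : ((W.baseChange K).baseChange (𝔳.adicCompletion K)).HasGoodReduction
          (𝔳.adicCompletionIntegers K) :=
        (hasGoodReduction_iff_of_isMinimal_of_eq_smul (𝔳.adicCompletionIntegers K)
          (rfl : (W.baseChange K).localMinimalModel 𝔳 =
            (((W.baseChange K).baseChange (𝔳.adicCompletion K)).exists_isMinimal
              (𝔳.adicCompletionIntegers K)).choose • (W.baseChange K).baseChange (𝔳.adicCompletion K))).mp
          hgood
      rw [X11b.Three.JetchevKummer.connectedKummerCondition_eq_of_goodReductionSubgroup_eq_top
        (W.baseChange K) (𝔳.adicCompletion K) (𝔳.adicCompletionIntegers K) hn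
        (WeierstrassCurve.goodReductionSubgroup_eq_top_of_hasGoodReduction
          (𝔳.adicCompletionIntegers K) _)]
      rw [WeierstrassCurve.kummerSelmerStructure_apply] at hKum
      exact hKum
    -- BAD minimal place: the stringent chain
    have hcv : (c : 𝓞 K) ∉ 𝔳.asIdeal := fun h ↦ by
      obtain ⟨ℓ, hℓ, hℓv⟩ := exists_primeFactor_mem_of_natCast_mem hc 𝔳 h
      exact hv ℓ hℓ ⟨𝔳, rfl, hℓv⟩
    have hND : IsCoprime (W.conductorNorm ℤ : ℤ) (NumberField.discr K) :=
      KolyvaginAssembly.isCoprime_discr_of_satisfiesHeegnerHypothesis hK hH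
    have hD : NumberField.discr K < -4 := KolyvaginAssembly.discr_lt_neg_four hK ⟨hD3, hD4⟩
    have hinert : ∀ (m' : ℕ), m' ∣ c → ∀ q ∈ m'.primeFactors, (Ideal.span {(q : 𝓞 K)}).IsPrime :=
      fun m' hm' q hq ↦ (hcK q (Nat.primeFactors_mono hm' hc.ne_zero hq)).1.2.2.2.2.1
    -- data at every divisor of `c` (the given `d` at `c` itself)
    have hne : ∀ m' : ℕ, m' ∣ c → Nonempty (KolyvaginHeegnerData Dt β ι m') := fun m' hm' ↦
      BirchSwinnertonDyer.Theorems.nonempty_kolyvaginHeegnerData_of_grossCM hCM1 hCM2 hK hH Dt β ι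
        d.dvd_sq_sub (hc.squarefree_of_dvd hm') (hinert m' hm')
    let data : (m' : ℕ) → m' ∣ c → KolyvaginHeegnerData Dt β ι m' := fun m' hm' ↦
      if h : m' = c then h ▸ d else (hne m' hm').some
    have hdata : data c dvd_rfl = d := by simp [data]
    have hcop : IsCoprime ((p ^ k : ℕ) : ℤ) n' := by
      rw [Nat.cast_pow]; exact IsCoprime.pow_left hcop'
    obtain ⟨t, htE, ht⟩ := exists_localKummerMap_eq_res_kolyvaginClass_concrete_of_GZ31_zhang hK ι hp Dt
      hND hD hc hcK data hcop
      (fun m hm γ hγ v hbad ↦ ⟨(hGZ m (data m hm) γ hγ v hbad).1,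
        fun ℓ hℓ hle ↦ (hGZ m (data m hm) γ hγ v hbad).2 ℓ hℓ _ hle⟩)
      (fun m hm ↦ RingClassNoTorsion.isAdmissible_pointsSubgroup _ hK
        (ne_zero_of_dvd_ne_zero hc.ne_zero hm) hp hp2 hρ k) hn c dvd_rfl 𝔳 hcv hgood
    rw [hdata] at ht
    -- `e(t) ∈ E⁰(K̄_v)` and `t` rational ⇒ `t ∈ E₀(K_v)` (B); `loc_v c = δ_v(t)`
    exact (X11b.Three.JetchevKummer.mem_connectedKummerCondition_iff (W.baseChange K) (𝔳.adicCompletion K)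
      (𝔳.adicCompletionIntegers K) hn _).mpr
      ⟨t, Receptacle.mem_goodReductionSubgroup_of_mem_E0Receptacle (W.baseChange K) 𝔳 t htE, ht⟩

end Summit.BirchSwinnertonDyer.Rank1Residual.JET

end
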